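import Summits.QuantumFields.YangMills.Theorems.ColdStartUniversalityLatticeLangevinLiebRobinsonCorrelationFreezing
import Summits.QuantumFields.YangMills.Theorems.ColdStartUniversalityLatticeLangevinLocalPoincare
import HarnessLib

/-!
# Route `ColdStartUniversality` (fixed-cut-off SZZ dynamics; LIEB–ROBINSON / LOCALITY package, file 34):
# ★★★ THE LIGHT CONE FOR DYNAMIC CORRELATIONS FROM A DETERMINISTIC START — integrated (dual) form, EVERY coupling

Helper file (seat `ym-line-csu-p1`, g32; `--supports stmt-QuantumFields-24809`).  For the `SU(2)` lattice Langevin dynamics of Shen–Zhu–Zhu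
on `(ℤ/L)³` at ANY coupling `β'`, any volume, any realising Markov kernel family `κ`: a deterministic start is a product state, and the
covariance of two observables at time `t` is CREATED only by noise injected at links where both backward-evolved observables are sensitive,
`κ_t(FG)(x) − κ_tF(x)·κ_tG(x) = ∫₀ᵗ κ_s(Γ(κ_(t−s)F, κ_(t−s)G))(x) ds`.  The Lieb–Robinson bound for the semigroup (g30,
`transitionKernel_linkLipschitz_profile`: the profile of `κ_rF` is `≤ e^(λr)·Σ_e' ℓ_e'·108^(−D(e',e))`, `λ = (1300+4√2)|β'|`) and the locality
of the bilinear carré du champ (g31, `abs_carre_bilin_le_of_linkLipschitz`) bound the integrand by the OVERLAP of the two light cones.  This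
file proves the INTEGRATED (test-function) form by the duality method of g29 (`…LocalPoincareFlow`: only Dynkin time-derivatives and the
`μ_(β')`-symmetry of the kernels; no time-regularity of spatial derivatives of the semigroup):
* ★★★ `abs_integral_mul_transition_covariance_le` — for `C³` compactly supported `f, g, h`, `H = h∘coords ≥ 0`, link-Lipschitz profiles
  `ℓ^F, ℓ^G ≥ 0` of `f∘coords, g∘coords` and every lattice time `t`:
  `|∫ H·κ_t(FG) dμ_(β') − ∫ H·κ_tF·κ_tG dμ_(β')| ≤ 16·t·e^(2λt)·S·∫ H dμ_(β')`, `S = Σ_e (Σ_e' ℓ^F_e' 108^(−D(e',e)))·(Σ_e' ℓ^G_e' 108^(−D(e',e)))`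
  (the overlap of the two light cones) — EVERY coupling, no small-`β'` window.
The pointwise form (every start, e.g. the cold start), the separated-support geometry and the solution form follow in file 35.  THEOREMS
ONLY, no definition, no sorry; [folklore] (Lieb–Robinson-type bounds on the creation of correlations from product states; BGL §4.7 for the
`Γ`-interpolation).  HONEST FRAMING: fixed cut-off; the cone slope `λ ∝ |β'|` gives NO `K`-uniform locality in physical units along the
route's scaling `β'_K = (γε_K)⁻¹/2 → ∞`; `UniformColdStartMixing` (24809) is NOT restated; no crux, rung or summit statement is proved; the
Yang–Mills mass gap is NOT proved.
-/

set_option autoImplicit false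

noncomputable section

namespace Summit.QuantumFields.YangMills.Theorems.ColdStartUniversality.LiebRobinson

open MeasureTheory ProbabilityTheory Matrix Complex Finset Filter Set Metric intervalIntegral
open scoped ComplexConjugate BigOperators Matrix NNReal ENNReal Topology
open Literature.Probability.Process Literature.MathematicalPhysics.QuantumFieldTheory
open Literature.MathematicalPhysics.QuantumFieldTheory.Balaban1983to89
open Literature.MathematicalPhysics.QuantumLattice (fundamentalRep fundamentalLatticeRep continuous_fundamentalRep fundamentalRep_apply)

variable {L : ℕ} [NeZero L]
/-! ## The integrated light-cone bound for dynamic covariances (every coupling) -/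

/-- ★★★ **Light cone for dynamic correlations, integrated form (every coupling `β'`, every volume `L`).**  For `C³` compactly
supported `f, g, h` with `H = h∘coords ≥ 0` on the group, link-Lipschitz profiles `ℓ^F, ℓ^G ≥ 0` of `f∘coords`, `g∘coords`, any realising
Markov kernel family `κ` and every lattice time `t`:
`|∫ H·κ_t(FG) dμ_(β') − ∫ H·(κ_tF)(κ_tG) dμ_(β')| ≤ 16·t·e^(2λt)·S·∫ H dμ_(β')`, `λ = |β'|(4+4√2+12·108)`,
`S = Σ_e (Σ_e' ℓ^F_e' 108^(−D(e',e)))(Σ_e' ℓ^G_e' 108^(−D(e',e)))`.  PROOF (duality): `Ψ(s) = ∫ κ_sH·κ_(t−s)F·κ_(t−s)G dμ` is continuous on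
`[0,t]` with `Ψ(t) − Ψ(0)` the left side (symmetry of `κ_t`, `κ_0 = id`); by Dynkin only, `Ψ'(s) = ∫ κ_s(𝓛H)·κ_(t−s)Fκ_(t−s)G −
κ_sH·(κ_(t−s)(𝓛F)·κ_(t−s)G + κ_(t−s)F·κ_(t−s)(𝓛G)) dμ = ∫ κ_sH·Γ^A(κ_(t−s)F, κ_(t−s)G) dμ` at the `C³_c` representatives
(`transitionKernel_backwardKolmogorov`, symmetry `integral_mul_generator_symm` + Leibniz `generator_mul_coords`); the two Lieb–Robinson profiles
(`transitionKernel_linkLipschitz_profile`) and `abs_carre_bilin_le_of_linkLipschitz` give `|Ψ'(s)| ≤ 16 e^(2λ(t−s)) S ∫ κ_sH dμ = 16 e^(2λ(t−s)) S ∫ H dμ`.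
[folklore] -/
theorem abs_integral_mul_transition_covariance_le (L : ℕ) [NeZero L] (β' : ℝ)
    (κ : ℝ≥0 → Kernel (GaugeConfig 3 L (Matrix.specialUnitaryGroup (Fin 2) ℂ))
      (GaugeConfig 3 L (Matrix.specialUnitaryGroup (Fin 2) ℂ))) [∀ t, IsMarkovKernel (κ t)]
    (hreal : ∀ (t : ℝ≥0) (x : GaugeConfig 3 L (Matrix.specialUnitaryGroup (Fin 2) ℂ))
        (Ω : Type) [MeasurableSpace Ω] (P : Measure Ω) [IsProbabilityMeasure P]
        (W : ℝ≥0 → Ω → (Edge 3 L × NoiseIdx 2 → ℝ)) (hW : IsFlatBrownian W P)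
        (U : ℝ≥0 → Ω → GaugeConfig 3 L (Matrix.specialUnitaryGroup (Fin 2) ℂ)),
        (∀ ω, U 0 ω = x) →
        (latticeLangevinDynamics (fundamentalLatticeRep 2) β').IsSolution (fundamentalRep (Fin 2))
          hW.natFiltration P W U →
        κ t x = P.map (U t))
    {f : (Edge 3 L × Fin 2 × Fin 2 × Bool → ℝ) → ℝ} (hf : ContDiff ℝ 3 f) (hfc : HasCompactSupport f) {ℓF : Edge 3 L → ℝ} (hℓF : ∀ e, 0 ≤ ℓF e)
    {g : (Edge 3 L × Fin 2 × Fin 2 × Bool → ℝ) → ℝ} (hg : ContDiff ℝ 3 g) (hgc : HasCompactSupport g) {ℓG : Edge 3 L → ℝ} (hℓG : ∀ e, 0 ≤ ℓG e)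
    {h : (Edge 3 L × Fin 2 × Fin 2 × Bool → ℝ) → ℝ} (hh : ContDiff ℝ 3 h) (hhc : HasCompactSupport h) (t : ℝ≥0) :
    let coords : GaugeConfig 3 L (Matrix.specialUnitaryGroup (Fin 2) ℂ) → (Edge 3 L × Fin 2 × Fin 2 × Bool → ℝ) :=
      fun V q => (fun z : ℂ => if q.2.2.2 then z.im else z.re)
        ((fundamentalRep (Fin 2) (V q.1) : Matrix (Fin 2) (Fin 2) ℂ) q.2.1 q.2.2.1)
    (∀ x, 0 ≤ h (coords x)) →
    (∀ (e : Edge 3 L) (y y' : (GaugeConfig 3 L (Matrix.specialUnitaryGroup (Fin 2) ℂ))), (∀ f', f' ≠ e → y f' = y' f') →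
      |f (coords y) - f (coords y')| ≤ ℓF e * frobNorm ((y e : Matrix (Fin 2) (Fin 2) ℂ) - (y' e : Matrix (Fin 2) (Fin 2) ℂ))) →
    (∀ (e : Edge 3 L) (y y' : (GaugeConfig 3 L (Matrix.specialUnitaryGroup (Fin 2) ℂ))), (∀ f', f' ≠ e → y f' = y' f') →
      |g (coords y) - g (coords y')| ≤ ℓG e * frobNorm ((y e : Matrix (Fin 2) (Fin 2) ℂ) - (y' e : Matrix (Fin 2) (Fin 2) ℂ))) →
    |(∫ x, h (coords x) * (∫ y, f (coords y) * g (coords y) ∂(κ t x)) ∂(wilsonMeasure (d := 3) (L := L) (fundamentalRep (Fin 2)) β')) -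
        ∫ x, h (coords x) * ((∫ y, f (coords y) ∂(κ t x)) * (∫ y, g (coords y) ∂(κ t x))) ∂(wilsonMeasure (d := 3) (L := L) (fundamentalRep (Fin 2)) β')| ≤
      16 * (t : ℝ) * Real.exp (2 * ((|β'| * (4 + 4 * Real.sqrt 2 + 12 * 108)) * (t : ℝ))) * (∑ e : Edge 3 L, (∑ e' : Edge 3 L, ℓF e' * ((108 : ℝ)⁻¹) ^ (Finset.univ.sup fun i : Fin 3 => ((e'.1 i - e.1 i).valMinAbs).natAbs)) * (∑ e' : Edge 3 L, ℓG e' * ((108 : ℝ)⁻¹) ^ (Finset.univ.sup fun i : Fin 3 => ((e'.1 i - e.1 i).valMinAbs).natAbs))) *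
        ∫ x, h (coords x) ∂(wilsonMeasure (d := 3) (L := L) (fundamentalRep (Fin 2)) β') := by
  intro coords hh0 hLf hLg
  classical
  set A : GaugeConfig 3 L (Matrix.specialUnitaryGroup (Fin 2) ℂ) → (Edge 3 L × Fin 2 × Fin 2 × Bool) →
        (Edge 3 L × Fin 2 × Fin 2 × Bool) → ℝ := fun V i j =>
      ∑ n : Edge 3 L × NoiseIdx 2,
        (if n.1 = i.1 then (fun z : ℂ => if i.2.2.2 then z.im else z.re)
          ((latticeLangevinDynamics (fundamentalLatticeRep 2) β').noise
            (matrixConfig (fundamentalRep (Fin 2)) V) i.1 n.2 i.2.1 i.2.2.1) else 0) *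
        (if n.1 = j.1 then (fun z : ℂ => if j.2.2.2 then z.im else z.re)
          ((latticeLangevinDynamics (fundamentalLatticeRep 2) β').noise
            (matrixConfig (fundamentalRep (Fin 2)) V) j.1 n.2 j.2.1 j.2.2.1) else 0) with hA_def
  set gen : ((Edge 3 L × Fin 2 × Fin 2 × Bool → ℝ) → ℝ) → (GaugeConfig 3 L (Matrix.specialUnitaryGroup (Fin 2) ℂ)) → ℝ := fun φ V =>
      (∑ i : Edge 3 L × Fin 2 × Fin 2 × Bool, fderiv ℝ φ (coords V) (Pi.single i 1) *
          (fun z : ℂ => if i.2.2.2 then z.im else z.re)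
            ((latticeLangevinDynamics (fundamentalLatticeRep 2) β').drift
              (matrixConfig (fundamentalRep (Fin 2)) V) i.1 i.2.1 i.2.2.1) +
      1 / 2 * ∑ i : Edge 3 L × Fin 2 × Fin 2 × Bool, ∑ j : Edge 3 L × Fin 2 × Fin 2 × Bool,
        fderiv ℝ (fun z => fderiv ℝ φ z (Pi.single i 1)) (coords V) (Pi.single j 1) * A V i j) with hgen_def
  haveI := secondCountableTopology_su2
  haveI := borelSpace_config L
  set μ : Measure (GaugeConfig 3 L (Matrix.specialUnitaryGroup (Fin 2) ℂ)) := (wilsonMeasure (d := 3) (L := L) (fundamentalRep (Fin 2)) β') with hμ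
  haveI : IsProbabilityMeasure μ :=
    isProbabilityMeasure_wilsonMeasure (d := 3) (L := L) (fundamentalRep (Fin 2)) (continuous_fundamentalRep (Fin 2)) β'
  have hco : Continuous coords := continuous_coords (L := L)
  have hInt : ∀ {Φ : (GaugeConfig 3 L (Matrix.specialUnitaryGroup (Fin 2) ℂ)) → ℝ}, Continuous Φ → Integrable Φ μ := fun hΦ => integrable_of_continuous_of_compactSpace hΦ μ
  have hκ0 : κ 0 = Kernel.id := transitionKernel_zero_eq_id (L := L) (β' := β') κ hreal
  -- the light-cone rate and the overlap sum
  set lam : ℝ := (|β'| * (4 + 4 * Real.sqrt 2 + 12 * 108)) with hlam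
  have hlam0 : 0 ≤ lam := by rw [hlam]; positivity
  set MF : Edge 3 L → ℝ := fun e => ∑ e' : Edge 3 L, ℓF e' * ((108 : ℝ)⁻¹) ^ (Finset.univ.sup fun i : Fin 3 => ((e'.1 i - e.1 i).valMinAbs).natAbs) with hMF
  set MG : Edge 3 L → ℝ := fun e => ∑ e' : Edge 3 L, ℓG e' * ((108 : ℝ)⁻¹) ^ (Finset.univ.sup fun i : Fin 3 => ((e'.1 i - e.1 i).valMinAbs).natAbs) with hMG
  have hMF0 : ∀ e, 0 ≤ MF e := fun e => Finset.sum_nonneg fun e' _ => mul_nonneg (hℓF e') (by positivity)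
  have hMG0 : ∀ e, 0 ≤ MG e := fun e => Finset.sum_nonneg fun e' _ => mul_nonneg (hℓG e') (by positivity)
  set S : ℝ := ∑ e : Edge 3 L, MF e * MG e with hS
  have hS0 : 0 ≤ S := Finset.sum_nonneg fun e _ => mul_nonneg (hMF0 e) (hMG0 e)
  set IH : ℝ := ∫ x, h (coords x) ∂μ with hIH
  -- §1 Dynkin-class representatives of `κ_s F`, `κ_s G`, `κ_s H`
  have hBKf := fun s : ℝ≥0 => transitionKernel_backwardKolmogorov (L := L) β' κ hreal hf hfc s
  have hBKg := fun s : ℝ≥0 => transitionKernel_backwardKolmogorov (L := L) β' κ hreal hg hgc s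
  have hBKh := fun s : ℝ≥0 => transitionKernel_backwardKolmogorov (L := L) β' κ hreal hh hhc s
  choose gF hgF hgFc hgFrep hgFcomm _ using hBKf
  choose gG hgG hgGc hgGrep hgGcomm _ using hBKg
  choose gH hgH hgHc hgHrep hgHcomm _ using hBKh
  have hgFrep' : ∀ (s : ℝ≥0) (x : (GaugeConfig 3 L (Matrix.specialUnitaryGroup (Fin 2) ℂ))), ∫ y, f (coords y) ∂(κ s x) = gF s (coords x) := fun s x => hgFrep s x
  have hgGrep' : ∀ (s : ℝ≥0) (x : (GaugeConfig 3 L (Matrix.specialUnitaryGroup (Fin 2) ℂ))), ∫ y, g (coords y) ∂(κ s x) = gG s (coords x) := fun s x => hgGrep s x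
  have hgHrep' : ∀ (s : ℝ≥0) (x : (GaugeConfig 3 L (Matrix.specialUnitaryGroup (Fin 2) ℂ))), ∫ y, h (coords y) ∂(κ s x) = gH s (coords x) := fun s x => hgHrep s x
  have hgFcomm' : ∀ (s : ℝ≥0) (x : (GaugeConfig 3 L (Matrix.specialUnitaryGroup (Fin 2) ℂ))), gen (gF s) x = ∫ y, gen f y ∂(κ s x) := fun s x => hgFcomm s x
  have hgGcomm' : ∀ (s : ℝ≥0) (x : (GaugeConfig 3 L (Matrix.specialUnitaryGroup (Fin 2) ℂ))), gen (gG s) x = ∫ y, gen g y ∂(κ s x) := fun s x => hgGcomm s x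
  have hgHcomm' : ∀ (s : ℝ≥0) (x : (GaugeConfig 3 L (Matrix.specialUnitaryGroup (Fin 2) ℂ))), gen (gH s) x = ∫ y, gen h y ∂(κ s x) := fun s x => hgHcomm s x

  -- §2 kernel actions as functions of real time: `PF = κF`, `PAF = κ(𝓛F)`, `PG`, `PAG`, `PH = κH`, `PB = κ(𝓛H)`
  have cF : Continuous fun y : (GaugeConfig 3 L (Matrix.specialUnitaryGroup (Fin 2) ℂ)) => f (coords y) := hf.continuous.comp hco
  have cGo : Continuous fun y : (GaugeConfig 3 L (Matrix.specialUnitaryGroup (Fin 2) ℂ)) => g (coords y) := hg.continuous.comp hco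
  have cFG : Continuous fun y : (GaugeConfig 3 L (Matrix.specialUnitaryGroup (Fin 2) ℂ)) => f (coords y) * g (coords y) := cF.mul cGo
  have cH : Continuous fun y : (GaugeConfig 3 L (Matrix.specialUnitaryGroup (Fin 2) ℂ)) => h (coords y) := hh.continuous.comp hco
  have cAf : Continuous (gen f) := continuous_generator (L := L) β' (hf.of_le (by norm_num))
  have cAg : Continuous (gen g) := continuous_generator (L := L) β' (hg.of_le (by norm_num))
  have cBh : Continuous (gen h) := continuous_generator (L := L) β' (hh.of_le (by norm_num))
  obtain ⟨PF, hPF⟩ : ∃ PF : ℝ → (GaugeConfig 3 L (Matrix.specialUnitaryGroup (Fin 2) ℂ)) → ℝ, PF = fun τ x => ∫ y, f (coords y) ∂(κ τ.toNNReal x) := ⟨_, rfl⟩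
  obtain ⟨PAF, hPAF⟩ : ∃ PAF : ℝ → (GaugeConfig 3 L (Matrix.specialUnitaryGroup (Fin 2) ℂ)) → ℝ, PAF = fun τ x => ∫ y, gen f y ∂(κ τ.toNNReal x) := ⟨_, rfl⟩
  obtain ⟨PG, hPG⟩ : ∃ PG : ℝ → (GaugeConfig 3 L (Matrix.specialUnitaryGroup (Fin 2) ℂ)) → ℝ, PG = fun τ x => ∫ y, g (coords y) ∂(κ τ.toNNReal x) := ⟨_, rfl⟩
  obtain ⟨PAG, hPAG⟩ : ∃ PAG : ℝ → (GaugeConfig 3 L (Matrix.specialUnitaryGroup (Fin 2) ℂ)) → ℝ, PAG = fun τ x => ∫ y, gen g y ∂(κ τ.toNNReal x) := ⟨_, rfl⟩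
  obtain ⟨PH, hPH⟩ : ∃ PH : ℝ → (GaugeConfig 3 L (Matrix.specialUnitaryGroup (Fin 2) ℂ)) → ℝ, PH = fun τ x => ∫ y, h (coords y) ∂(κ τ.toNNReal x) := ⟨_, rfl⟩
  obtain ⟨PB, hPB⟩ : ∃ PB : ℝ → (GaugeConfig 3 L (Matrix.specialUnitaryGroup (Fin 2) ℂ)) → ℝ, PB = fun τ x => ∫ y, gen h y ∂(κ τ.toNNReal x) := ⟨_, rfl⟩
  have hcx : ∀ {Φ : (GaugeConfig 3 L (Matrix.specialUnitaryGroup (Fin 2) ℂ)) → ℝ}, Continuous Φ → ∀ τ : ℝ, Continuous fun x => ∫ y, Φ y ∂(κ τ.toNNReal x) :=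
    fun hΦ τ => continuous_integral_transitionKernel L β' κ hreal τ.toNNReal hΦ
  have hct : ∀ {Φ : (GaugeConfig 3 L (Matrix.specialUnitaryGroup (Fin 2) ℂ)) → ℝ}, Continuous Φ → ∀ x : (GaugeConfig 3 L (Matrix.specialUnitaryGroup (Fin 2) ℂ)), Continuous fun τ : ℝ => ∫ y, Φ y ∂(κ τ.toNNReal x) :=
    fun hΦ x => (continuous_transitionKernel_action (L := L) β' κ hreal hΦ).comp (continuous_real_toNNReal.prodMk continuous_const)
  have hbd : ∀ {Φ : (GaugeConfig 3 L (Matrix.specialUnitaryGroup (Fin 2) ℂ)) → ℝ}, Continuous Φ → ∃ M : ℝ, ∀ (τ : ℝ) (x : (GaugeConfig 3 L (Matrix.specialUnitaryGroup (Fin 2) ℂ))), |∫ y, Φ y ∂(κ τ.toNNReal x)| ≤ M := by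
    intro Φ hΦ
    obtain ⟨M, hM⟩ : ∃ M, ∀ y : (GaugeConfig 3 L (Matrix.specialUnitaryGroup (Fin 2) ℂ)), |Φ y| ≤ M := by
      obtain ⟨M, hM⟩ := isCompact_univ.exists_bound_of_continuousOn hΦ.continuousOn
      exact ⟨M, fun y => by simpa [Real.norm_eq_abs] using hM y (Set.mem_univ y)⟩
    refine ⟨M, fun τ x => ?_⟩
    haveI : IsProbabilityMeasure (κ τ.toNNReal x) := IsMarkovKernel.isProbabilityMeasure x
    refine (MeasureTheory.abs_integral_le_integral_abs).trans ?_
    calc ∫ y, |Φ y| ∂(κ τ.toNNReal x) ≤ ∫ _y, M ∂(κ τ.toNNReal x) :=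
          integral_mono (integrable_of_continuous_of_compactSpace (continuous_abs.comp hΦ) _) (integrable_const _) fun y => hM y
      _ = M := by simp
  have h0 : ∀ {Φ : (GaugeConfig 3 L (Matrix.specialUnitaryGroup (Fin 2) ℂ)) → ℝ}, Continuous Φ → ∀ x : (GaugeConfig 3 L (Matrix.specialUnitaryGroup (Fin 2) ℂ)), ∫ y, Φ y ∂(κ (0 : ℝ).toNNReal x) = Φ x := by
    intro Φ hΦ x
    rw [Real.toNNReal_zero, hκ0, Kernel.id_apply, integral_dirac' _ _ hΦ.measurable.stronglyMeasurable]
  have hDer : ∀ {φ : (Edge 3 L × Fin 2 × Fin 2 × Bool → ℝ) → ℝ}, ContDiff ℝ 3 φ → HasCompactSupport φ → ∀ (x : (GaugeConfig 3 L (Matrix.specialUnitaryGroup (Fin 2) ℂ))) {τ : ℝ}, 0 < τ →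
      HasDerivAt (fun τ : ℝ => ∫ y, φ (coords y) ∂(κ τ.toNNReal x)) (∫ y, gen φ y ∂(κ τ.toNNReal x)) τ := by
    intro φ hφ hφc x τ hτ
    have hDf := fun {σ : ℝ} (hσ : (0 : ℝ) ≤ σ) => transitionKernel_dynkin (L := L) β' κ hreal hφ hφc x hσ
    have hgc : Continuous (gen φ) := continuous_generator (L := L) β' (hφ.of_le (by norm_num))
    have hac : Continuous fun r : ℝ => ∫ y, gen φ y ∂(κ r.toNNReal x) := hct hgc x
    have hder : HasDerivAt (fun σ : ℝ => φ (coords x) + ∫ r in (0 : ℝ)..σ, ∫ y, gen φ y ∂(κ r.toNNReal x))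
        (∫ y, gen φ y ∂(κ τ.toNNReal x)) τ :=
      ((intervalIntegral.integral_hasDerivAt_right (hac.intervalIntegrable _ _)
        (hac.stronglyMeasurableAtFilter _ _) hac.continuousAt)).const_add _
    refine hder.congr_of_eventuallyEq ?_
    filter_upwards [Ioi_mem_nhds hτ] with σ hσ
    exact hDf (le_of_lt hσ)
  obtain ⟨MFb, hMFb⟩ := hbd cF; obtain ⟨MAF, hMAF⟩ := hbd cAf; obtain ⟨MGb, hMGb⟩ := hbd cGo
  obtain ⟨MAG, hMAG⟩ := hbd cAg; obtain ⟨MH, hMH⟩ := hbd cH; obtain ⟨MB, hMB⟩ := hbd cBh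
  have bF : ∀ τ x, |PF τ x| ≤ MFb := fun τ x => by rw [hPF]; exact hMFb τ x
  have bAF : ∀ τ x, |PAF τ x| ≤ MAF := fun τ x => by rw [hPAF]; exact hMAF τ x
  have bG : ∀ τ x, |PG τ x| ≤ MGb := fun τ x => by rw [hPG]; exact hMGb τ x
  have bAG : ∀ τ x, |PAG τ x| ≤ MAG := fun τ x => by rw [hPAG]; exact hMAG τ x
  have bH : ∀ τ x, |PH τ x| ≤ MH := fun τ x => by rw [hPH]; exact hMH τ x
  have bB : ∀ τ x, |PB τ x| ≤ MB := fun τ x => by rw [hPB]; exact hMB τ x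
  have cxF : ∀ τ, Continuous fun x => PF τ x := fun τ => by rw [hPF]; exact hcx cF τ
  have cxAF : ∀ τ, Continuous fun x => PAF τ x := fun τ => by rw [hPAF]; exact hcx cAf τ
  have cxG : ∀ τ, Continuous fun x => PG τ x := fun τ => by rw [hPG]; exact hcx cGo τ
  have cxAG : ∀ τ, Continuous fun x => PAG τ x := fun τ => by rw [hPAG]; exact hcx cAg τ
  have cxH : ∀ τ, Continuous fun x => PH τ x := fun τ => by rw [hPH]; exact hcx cH τ
  have cxB : ∀ τ, Continuous fun x => PB τ x := fun τ => by rw [hPB]; exact hcx cBh τ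
  have ctF : ∀ x, Continuous fun τ => PF τ x := fun x => by rw [hPF]; exact hct cF x
  have ctG : ∀ x, Continuous fun τ => PG τ x := fun x => by rw [hPG]; exact hct cGo x
  have ctH : ∀ x, Continuous fun τ => PH τ x := fun x => by rw [hPH]; exact hct cH x
  have dF : ∀ x {τ : ℝ}, 0 < τ → HasDerivAt (fun τ => PF τ x) (PAF τ x) τ := fun x τ hτ => by
    rw [hPF, hPAF]; exact hDer hf hfc x hτ
  have dG : ∀ x {τ : ℝ}, 0 < τ → HasDerivAt (fun τ => PG τ x) (PAG τ x) τ := fun x τ hτ => by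
    rw [hPG, hPAG]; exact hDer hg hgc x hτ
  have dH : ∀ x {τ : ℝ}, 0 < τ → HasDerivAt (fun τ => PH τ x) (PB τ x) τ := fun x τ hτ => by
    rw [hPH, hPB]; exact hDer hh hhc x hτ
  -- §3 `Ψ(s) = ∫ κ_sH·κ_(T−s)F·κ_(T−s)G dμ`, its derivative `Λ`, and the bound `Mb`
  set T : ℝ := (t : ℝ) with hT
  have hT0 : 0 ≤ T := t.coe_nonneg; have hTt : T.toNNReal = t := by rw [hT, Real.toNNReal_coe]
  obtain ⟨Ψ, hΨ⟩ : ∃ Ψ : ℝ → ℝ, Ψ = fun σ => ∫ x, PH σ x * (PF (T - σ) x * PG (T - σ) x) ∂μ := ⟨_, rfl⟩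
  obtain ⟨Λ, hΛ⟩ : ∃ Λ : ℝ → ℝ, Λ = fun σ => ∫ x, (PB σ x * (PF (T - σ) x * PG (T - σ) x) -
      PH σ x * (PF (T - σ) x * PAG (T - σ) x + PG (T - σ) x * PAF (T - σ) x)) ∂μ := ⟨_, rfl⟩
  set Mb : ℝ := 16 * Real.exp (2 * (lam * T)) * S * IH with hMb
  have hΨc : Continuous Ψ := by
    rw [hΨ]
    refine continuous_of_dominated (bound := fun _ => MH * (MFb * MGb)) (fun σ => ?_) (fun σ => ?_)
      (integrable_const _) (ae_of_all _ fun x => ?_)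
    · exact ((cxH σ).mul ((cxF _).mul (cxG _))).aestronglyMeasurable
    · exact ae_of_all _ fun x => by rw [Real.norm_eq_abs]; exact abs_mul_mul_le (bH σ x) (bF (T - σ) x) (bG (T - σ) x)
    · have cs : Continuous fun σ : ℝ => T - σ := continuous_const.sub continuous_id
      exact (ctH x).mul (((ctF x).comp cs).mul ((ctG x).comp cs))
  have hΨder : ∀ σ ∈ Ioo 0 T, HasDerivAt Ψ (Λ σ) σ := by
    intro σ ⟨hσ0, hσT⟩
    rw [hΨ, hΛ]
    have hs : Ioo (σ / 2) ((σ + T) / 2) ∈ 𝓝 σ := Ioo_mem_nhds (by linarith) (by linarith)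
    refine (hasDerivAt_integral_of_dominated_loc_of_deriv_le (μ := μ) (x₀ := σ)
      (F := fun σ x => PH σ x * (PF (T - σ) x * PG (T - σ) x))
      (F' := fun σ x => PB σ x * (PF (T - σ) x * PG (T - σ) x) - PH σ x * (PF (T - σ) x * PAG (T - σ) x + PG (T - σ) x * PAF (T - σ) x))
      (bound := fun _ => MB * (MFb * MGb) + MH * (MFb * MAG + MGb * MAF)) hs ?_ ?_ ?_ ?_ (integrable_const _) ?_).2
    · exact Filter.Eventually.of_forall fun σ' => ((cxH σ').mul ((cxF _).mul (cxG _))).aestronglyMeasurable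
    · exact hInt ((cxH σ).mul ((cxF _).mul (cxG _)))
    · exact (((cxB σ).mul ((cxF _).mul (cxG _))).sub ((cxH σ).mul (((cxF _).mul (cxAG _)).add ((cxG _).mul (cxAF _))))).aestronglyMeasurable
    · refine ae_of_all _ fun x σ' _ => ?_
      rw [Real.norm_eq_abs]
      refine (abs_sub _ _).trans (add_le_add (abs_mul_mul_le (bB σ' x) (bF (T - σ') x) (bG (T - σ') x)) ?_)
      rw [abs_mul]
      refine mul_le_mul (bH σ' x) ((abs_add_le _ _).trans (add_le_add ?_ ?_)) (abs_nonneg _) ((abs_nonneg _).trans (bH σ' x))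
      · rw [abs_mul]; exact mul_le_mul (bF (T - σ') x) (bAG (T - σ') x) (abs_nonneg _) ((abs_nonneg _).trans (bF (T - σ') x))
      · rw [abs_mul]; exact mul_le_mul (bG (T - σ') x) (bAF (T - σ') x) (abs_nonneg _) ((abs_nonneg _).trans (bG (T - σ') x))
    · refine ae_of_all _ fun x σ' ⟨hσ'1, hσ'2⟩ => ?_
      have hσ'0 : 0 < σ' := by linarith
      have hTσ' : 0 < T - σ' := by linarith
      have eH := dH x hσ'0
      have eF : HasDerivAt (fun σ => PF (T - σ) x) (-(PAF (T - σ') x)) σ' := by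
        have hc := HasDerivAt.comp σ' (dF x hTσ') ((hasDerivAt_id σ').const_sub T)
        exact hc.congr_deriv (by ring)
      have eG : HasDerivAt (fun σ => PG (T - σ) x) (-(PAG (T - σ') x)) σ' := by
        have hc := HasDerivAt.comp σ' (dG x hTσ') ((hasDerivAt_id σ').const_sub T)
        exact hc.congr_deriv (by ring)
      have hall := eH.mul (eF.mul eG)
      show HasDerivAt (fun σ => PH σ x * (PF (T - σ) x * PG (T - σ) x))
        (PB σ' x * (PF (T - σ') x * PG (T - σ') x) - PH σ' x * (PF (T - σ') x * PAG (T - σ') x + PG (T - σ') x * PAF (T - σ') x)) σ'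
      refine hall.congr_deriv ?_
      show PB σ' x * (PF (T - σ') x * PG (T - σ') x) + PH σ' x * (-(PAF (T - σ') x) * PG (T - σ') x + PF (T - σ') x * -(PAG (T - σ') x)) = _
      ring
  -- §4 the key bound `|Λ(s)| ≤ Mb` on `(0, T)` (value identity, two Lieb–Robinson profiles, locality of `Γ^A`, invariance)
  have hkey : ∀ σ ∈ Ioo 0 T, |Λ σ| ≤ Mb := by
    intro σ hσ
    obtain ⟨hσ0, hσT⟩ := hσ
    set s₁ : ℝ≥0 := σ.toNNReal with hs₁
    set s₂ : ℝ≥0 := (T - σ).toNNReal with hs₂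
    have hs₂R : ((s₂ : ℝ≥0) : ℝ) = T - σ := by rw [hs₂, Real.coe_toNNReal _ (by linarith)]
    have eH : ∀ x, PH σ x = gH s₁ (coords x) := fun x => by rw [hPH]; exact hgHrep' s₁ x
    have eB : ∀ x, PB σ x = gen (gH s₁) x := fun x => by rw [hPB, hgHcomm' s₁ x]
    have eF : ∀ x, PF (T - σ) x = gF s₂ (coords x) := fun x => by rw [hPF]; exact hgFrep' s₂ x
    have eG : ∀ x, PG (T - σ) x = gG s₂ (coords x) := fun x => by rw [hPG]; exact hgGrep' s₂ x
    have eAF : ∀ x, PAF (T - σ) x = gen (gF s₂) x := fun x => by rw [hPAF, hgFcomm' s₂ x]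
    have eAG : ∀ x, PAG (T - σ) x = gen (gG s₂) x := fun x => by rw [hPAG, hgGcomm' s₂ x]
    have hG0 : ∀ x, 0 ≤ gH s₁ (coords x) := fun x => by
      rw [← hgHrep' s₁ x]
      exact integral_nonneg fun y => hh0 y
    -- the polarised value identity `∫ (𝓛G'·uw − G'·(u𝓛w + w𝓛u)) dμ = ∫ G'·Γ^A(u,w) dμ` at the representatives (symmetry + Leibniz)
    have hu2 : ContDiff ℝ 2 (gF s₂) := (hgF s₂).of_le (by norm_num)
    have hw2 : ContDiff ℝ 2 (gG s₂) := (hgG s₂).of_le (by norm_num)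
    have cG1 : Continuous fun x : (GaugeConfig 3 L (Matrix.specialUnitaryGroup (Fin 2) ℂ)) => gH s₁ (coords x) := (hgH s₁).continuous.comp hco
    have cu : Continuous fun x : (GaugeConfig 3 L (Matrix.specialUnitaryGroup (Fin 2) ℂ)) => gF s₂ (coords x) := (hgF s₂).continuous.comp hco
    have cw : Continuous fun x : (GaugeConfig 3 L (Matrix.specialUnitaryGroup (Fin 2) ℂ)) => gG s₂ (coords x) := (hgG s₂).continuous.comp hco
    have cgu : Continuous (gen (gF s₂)) := continuous_generator (L := L) β' hu2
    have cgw : Continuous (gen (gG s₂)) := continuous_generator (L := L) β' hw2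
    have cgG1 : Continuous (gen (gH s₁)) := continuous_generator (L := L) β' ((hgH s₁).of_le (by norm_num))
    have cguw : Continuous (gen fun z => gF s₂ z * gG s₂ z) := continuous_generator (L := L) β' (((hgF s₂).mul (hgG s₂)).of_le (by norm_num))
    have hleib : ∀ x : (GaugeConfig 3 L (Matrix.specialUnitaryGroup (Fin 2) ℂ)), gen (fun z => gF s₂ z * gG s₂ z) x = gF s₂ (coords x) * gen (gG s₂) x + gG s₂ (coords x) * gen (gF s₂) x +
        (∑ i : Edge 3 L × Fin 2 × Fin 2 × Bool, ∑ j : Edge 3 L × Fin 2 × Fin 2 × Bool, fderiv ℝ (gF s₂) (coords x) (Pi.single i 1) * fderiv ℝ (gG s₂) (coords x) (Pi.single j 1) * A x i j) :=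
      fun x => generator_mul_coords L β' hu2 hw2 x
    have cΓ : Continuous fun x : (GaugeConfig 3 L (Matrix.specialUnitaryGroup (Fin 2) ℂ)) => (∑ i : Edge 3 L × Fin 2 × Fin 2 × Bool, ∑ j : Edge 3 L × Fin 2 × Fin 2 × Bool, fderiv ℝ (gF s₂) (coords x) (Pi.single i 1) * fderiv ℝ (gG s₂) (coords x) (Pi.single j 1) * A x i j) := by
      have e : (fun x : (GaugeConfig 3 L (Matrix.specialUnitaryGroup (Fin 2) ℂ)) => (∑ i : Edge 3 L × Fin 2 × Fin 2 × Bool, ∑ j : Edge 3 L × Fin 2 × Fin 2 × Bool, fderiv ℝ (gF s₂) (coords x) (Pi.single i 1) * fderiv ℝ (gG s₂) (coords x) (Pi.single j 1) * A x i j)) =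
          fun x => gen (fun z => gF s₂ z * gG s₂ z) x - (gF s₂ (coords x) * gen (gG s₂) x + gG s₂ (coords x) * gen (gF s₂) x) := by
        funext x; rw [hleib x]; ring
      rw [e]; exact cguw.sub ((cu.mul cgw).add (cw.mul cgu))
    have hsymm : ∫ x, (gF s₂ (coords x) * gG s₂ (coords x)) * gen (gH s₁) x ∂μ = ∫ x, gH s₁ (coords x) * gen (fun z => gF s₂ z * gG s₂ z) x ∂μ :=
      integral_mul_generator_symm L β' (hgH s₁) (hgHc s₁) ((hgF s₂).mul (hgG s₂)) (hgFc s₂).mul_right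
    have hval : ∫ x, (gen (gH s₁) x * (gF s₂ (coords x) * gG s₂ (coords x)) - gH s₁ (coords x) * (gF s₂ (coords x) * gen (gG s₂) x + gG s₂ (coords x) * gen (gF s₂) x)) ∂μ =
        ∫ x, gH s₁ (coords x) * (∑ i : Edge 3 L × Fin 2 × Fin 2 × Bool, ∑ j : Edge 3 L × Fin 2 × Fin 2 × Bool, fderiv ℝ (gF s₂) (coords x) (Pi.single i 1) * fderiv ℝ (gG s₂) (coords x) (Pi.single j 1) * A x i j) ∂μ := by
      have i1 : Integrable (fun x => (gF s₂ (coords x) * gG s₂ (coords x)) * gen (gH s₁) x) μ := hInt ((cu.mul cw).mul cgG1)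
      have i2 : Integrable (fun x => gH s₁ (coords x) * (gF s₂ (coords x) * gen (gG s₂) x + gG s₂ (coords x) * gen (gF s₂) x)) μ := hInt (cG1.mul ((cu.mul cgw).add (cw.mul cgu)))
      have e1 : ∫ x, (gen (gH s₁) x * (gF s₂ (coords x) * gG s₂ (coords x)) - gH s₁ (coords x) * (gF s₂ (coords x) * gen (gG s₂) x + gG s₂ (coords x) * gen (gF s₂) x)) ∂μ =
          ∫ x, (gF s₂ (coords x) * gG s₂ (coords x)) * gen (gH s₁) x ∂μ - ∫ x, gH s₁ (coords x) * (gF s₂ (coords x) * gen (gG s₂) x + gG s₂ (coords x) * gen (gF s₂) x) ∂μ := by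
        rw [← integral_sub i1 i2]; exact integral_congr_ae (ae_of_all _ fun x => by ring)
      have i3 : Integrable (fun x => gH s₁ (coords x) * gen (fun z => gF s₂ z * gG s₂ z) x) μ := hInt (cG1.mul cguw)
      rw [e1, hsymm, ← integral_sub i3 i2]
      refine integral_congr_ae (ae_of_all _ fun x => ?_)
      show gH s₁ (coords x) * gen (fun z => gF s₂ z * gG s₂ z) x - gH s₁ (coords x) * (gF s₂ (coords x) * gen (gG s₂) x + gG s₂ (coords x) * gen (gF s₂) x) = _
      rw [hleib x]; ring
    have hΛσ : Λ σ = ∫ x, gH s₁ (coords x) * (∑ i : Edge 3 L × Fin 2 × Fin 2 × Bool, ∑ j : Edge 3 L × Fin 2 × Fin 2 × Bool, fderiv ℝ (gF s₂) (coords x) (Pi.single i 1) * fderiv ℝ (gG s₂) (coords x) (Pi.single j 1) * A x i j) ∂μ := by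
      rw [hΛ, ← hval]
      exact integral_congr_ae (ae_of_all _ fun x => by simp only [eB x, eH x, eF x, eG x, eAF x, eAG x])
    -- Lieb–Robinson profiles of the representatives
    have hLF : ∀ (e : Edge 3 L) (y y' : (GaugeConfig 3 L (Matrix.specialUnitaryGroup (Fin 2) ℂ))), (∀ f', f' ≠ e → y f' = y' f') →
        |gF s₂ (coords y) - gF s₂ (coords y')| ≤ (Real.exp (lam * (s₂ : ℝ)) * MF e) * frobNorm ((y e : Matrix (Fin 2) (Fin 2) ℂ) - (y' e : Matrix (Fin 2) (Fin 2) ℂ)) := by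
      intro e y y' hyy'
      rw [← hgFrep' s₂ y, ← hgFrep' s₂ y']
      have h1 := transitionKernel_linkLipschitz_profile L β' κ hreal cF hℓF hLf s₂ e y y' hyy'
      rw [hMF]; exact h1
    have hLG : ∀ (e : Edge 3 L) (y y' : (GaugeConfig 3 L (Matrix.specialUnitaryGroup (Fin 2) ℂ))), (∀ f', f' ≠ e → y f' = y' f') →
        |gG s₂ (coords y) - gG s₂ (coords y')| ≤ (Real.exp (lam * (s₂ : ℝ)) * MG e) * frobNorm ((y e : Matrix (Fin 2) (Fin 2) ℂ) - (y' e : Matrix (Fin 2) (Fin 2) ℂ)) := by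
      intro e y y' hyy'
      rw [← hgGrep' s₂ y, ← hgGrep' s₂ y']
      have h1 := transitionKernel_linkLipschitz_profile L β' κ hreal cGo hℓG hLg s₂ e y y' hyy'
      rw [hMG]; exact h1
    have hmF0 : ∀ e, 0 ≤ Real.exp (lam * (s₂ : ℝ)) * MF e := fun e => mul_nonneg (Real.exp_nonneg _) (hMF0 e)
    have hmG0 : ∀ e, 0 ≤ Real.exp (lam * (s₂ : ℝ)) * MG e := fun e => mul_nonneg (Real.exp_nonneg _) (hMG0 e)
    have hpt : ∀ x : (GaugeConfig 3 L (Matrix.specialUnitaryGroup (Fin 2) ℂ)),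
        |∑ i : Edge 3 L × Fin 2 × Fin 2 × Bool, ∑ j : Edge 3 L × Fin 2 × Fin 2 × Bool, fderiv ℝ (gF s₂) (coords x) (Pi.single i 1) * fderiv ℝ (gG s₂) (coords x) (Pi.single j 1) * A x i j| ≤
          16 * ∑ e : Edge 3 L, (Real.exp (lam * (s₂ : ℝ)) * MF e) * (Real.exp (lam * (s₂ : ℝ)) * MG e) :=
      fun x => abs_carre_bilin_le_of_linkLipschitz L β' ((hgF s₂).of_le (by norm_num)) ((hgG s₂).of_le (by norm_num)) hmF0 hmG0 x hLF hLG
    -- `e^(λ s₂)² ≤ e^(2λT)`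
    have hexp : Real.exp (lam * (s₂ : ℝ)) * Real.exp (lam * (s₂ : ℝ)) ≤ Real.exp (2 * (lam * T)) := by
      rw [← Real.exp_add, Real.exp_le_exp, hs₂R]
      nlinarith [mul_nonneg hlam0 hσ0.le]
    have hsum : 16 * ∑ e : Edge 3 L, (Real.exp (lam * (s₂ : ℝ)) * MF e) * (Real.exp (lam * (s₂ : ℝ)) * MG e) ≤ 16 * Real.exp (2 * (lam * T)) * S := by
      have e1 : ∑ e : Edge 3 L, (Real.exp (lam * (s₂ : ℝ)) * MF e) * (Real.exp (lam * (s₂ : ℝ)) * MG e) =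
          (Real.exp (lam * (s₂ : ℝ)) * Real.exp (lam * (s₂ : ℝ))) * S := by
        rw [hS, Finset.mul_sum]
        exact Finset.sum_congr rfl fun e _ => by ring
      rw [e1]
      have h2 : Real.exp (lam * (s₂ : ℝ)) * Real.exp (lam * (s₂ : ℝ)) * S ≤ Real.exp (2 * (lam * T)) * S :=
        mul_le_mul_of_nonneg_right hexp hS0
      linarith
    have hptx : ∀ x : (GaugeConfig 3 L (Matrix.specialUnitaryGroup (Fin 2) ℂ)),
        |gH s₁ (coords x) * (∑ i : Edge 3 L × Fin 2 × Fin 2 × Bool, ∑ j : Edge 3 L × Fin 2 × Fin 2 × Bool, fderiv ℝ (gF s₂) (coords x) (Pi.single i 1) * fderiv ℝ (gG s₂) (coords x) (Pi.single j 1) * A x i j)| ≤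
          (16 * Real.exp (2 * (lam * T)) * S) * gH s₁ (coords x) := by
      intro x
      rw [abs_mul, abs_of_nonneg (hG0 x), mul_comm]
      exact mul_le_mul_of_nonneg_right ((hpt x).trans hsum) (hG0 x)
    -- invariance `∫ κ_(s₁)H dμ = ∫ H dμ`
    have hinv : ∫ x, gH s₁ (coords x) ∂μ = IH := by
      rw [hIH]
      have h1 : ∫ x, gH s₁ (coords x) ∂μ = ∫ x, (∫ y, h (coords y) ∂(κ s₁ x)) ∂μ := integral_congr_ae (ae_of_all _ fun x => (hgHrep' s₁ x).symm)
      rw [h1]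
      exact integral_transitionKernel_integral_eq_wilson (L := L) β' κ hreal s₁ cH.measurable ⟨MH, fun x => by
        have := hMH 0 x; rw [h0 cH x] at this; exact this⟩
    rw [hΛσ]
    calc |∫ x, gH s₁ (coords x) * (∑ i : Edge 3 L × Fin 2 × Fin 2 × Bool, ∑ j : Edge 3 L × Fin 2 × Fin 2 × Bool, fderiv ℝ (gF s₂) (coords x) (Pi.single i 1) * fderiv ℝ (gG s₂) (coords x) (Pi.single j 1) * A x i j) ∂μ|
        ≤ ∫ x, |gH s₁ (coords x) * (∑ i : Edge 3 L × Fin 2 × Fin 2 × Bool, ∑ j : Edge 3 L × Fin 2 × Fin 2 × Bool, fderiv ℝ (gF s₂) (coords x) (Pi.single i 1) * fderiv ℝ (gG s₂) (coords x) (Pi.single j 1) * A x i j)| ∂μ :=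
          MeasureTheory.abs_integral_le_integral_abs
      _ ≤ ∫ x, (16 * Real.exp (2 * (lam * T)) * S) * gH s₁ (coords x) ∂μ :=
          integral_mono_of_nonneg (ae_of_all _ fun x => abs_nonneg _) ((hInt cG1).const_mul _) (ae_of_all _ fun x => hptx x)
      _ = Mb := by rw [MeasureTheory.integral_const_mul, hinv, hMb]
  -- §5 `Ψ(s) ∓ Mb·s` are monotone on `[0, T]`
  have hup : AntitoneOn (fun σ => Ψ σ - Mb * σ) (Icc 0 T) := by
    have hΘc : ContinuousOn (fun σ => Ψ σ - Mb * σ) (Icc 0 T) := (hΨc.sub (continuous_const.mul continuous_id)).continuousOn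
    have hΘd : ∀ σ ∈ Ioo 0 T, HasDerivAt (fun σ => Ψ σ - Mb * σ) (Λ σ - Mb * 1) σ := fun σ hσ =>
      (hΨder σ hσ).sub ((hasDerivAt_id' σ).const_mul Mb)
    refine antitoneOn_of_deriv_nonpos (convex_Icc 0 T) hΘc (fun σ hσ => ?_) (fun σ hσ => ?_)
    · rw [interior_Icc] at hσ
      exact (hΘd σ hσ).differentiableAt.differentiableWithinAt
    · rw [interior_Icc] at hσ
      rw [(hΘd σ hσ).deriv]
      have h := (abs_le.1 (hkey σ hσ)).2
      linarith
  have hdown : MonotoneOn (fun σ => Ψ σ + Mb * σ) (Icc 0 T) := by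
    have hΘc : ContinuousOn (fun σ => Ψ σ + Mb * σ) (Icc 0 T) := (hΨc.add (continuous_const.mul continuous_id)).continuousOn
    have hΘd : ∀ σ ∈ Ioo 0 T, HasDerivAt (fun σ => Ψ σ + Mb * σ) (Λ σ + Mb * 1) σ := fun σ hσ =>
      (hΨder σ hσ).add ((hasDerivAt_id' σ).const_mul Mb)
    refine monotoneOn_of_deriv_nonneg (convex_Icc 0 T) hΘc (fun σ hσ => ?_) (fun σ hσ => ?_)
    · rw [interior_Icc] at hσ
      exact (hΘd σ hσ).differentiableAt.differentiableWithinAt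
    · rw [interior_Icc] at hσ
      rw [(hΘd σ hσ).deriv]
      have h := (abs_le.1 (hkey σ hσ)).1
      linarith
  have hΘup := hup (left_mem_Icc.2 hT0) (right_mem_Icc.2 hT0) hT0
  have hΘdown := hdown (left_mem_Icc.2 hT0) (right_mem_Icc.2 hT0) hT0
  simp only [mul_zero, sub_zero, add_zero] at hΘup hΘdown
  -- §6 the endpoints `Ψ(T) = ∫ H·κ_t(FG)`, `Ψ(0) = ∫ H·κ_tF·κ_tG`
  have hΨT : Ψ T = ∫ x, h (coords x) * (∫ y, f (coords y) * g (coords y) ∂(κ t x)) ∂μ := by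
    have eF : ∀ x, PF (T - T) x = f (coords x) := fun x => by rw [hPF, sub_self]; exact h0 cF x
    have eG : ∀ x, PG (T - T) x = g (coords x) := fun x => by rw [hPG, sub_self]; exact h0 cGo x
    have eH : ∀ x, PH T x = ∫ y, h (coords y) ∂(κ t x) := fun x => by rw [hPH]; show ∫ y, h (coords y) ∂(κ T.toNNReal x) = _; rw [hTt]
    rw [hΨ]
    calc (fun σ => ∫ x, PH σ x * (PF (T - σ) x * PG (T - σ) x) ∂μ) T = ∫ x, (∫ y, h (coords y) ∂(κ t x)) * (f (coords x) * g (coords x)) ∂μ :=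
          integral_congr_ae (ae_of_all _ fun x => by simp only [eF x, eG x, eH x])
      _ = ∫ x, (f (coords x) * g (coords x)) * (∫ y, h (coords y) ∂(κ t x)) ∂μ := integral_congr_ae (ae_of_all _ fun x => mul_comm _ _)
      _ = ∫ x, h (coords x) * (∫ y, f (coords y) * g (coords y) ∂(κ t x)) ∂μ := (integral_mul_transition_symm_su2 L β' κ hreal t cH cFG).symm
  have hΨ0 : Ψ 0 = ∫ x, h (coords x) * ((∫ y, f (coords y) ∂(κ t x)) * (∫ y, g (coords y) ∂(κ t x))) ∂μ := by
    have eF : ∀ x, PF T x = ∫ y, f (coords y) ∂(κ t x) := fun x => by rw [hPF]; show ∫ y, f (coords y) ∂(κ T.toNNReal x) = _; rw [hTt]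
    have eG : ∀ x, PG T x = ∫ y, g (coords y) ∂(κ t x) := fun x => by rw [hPG]; show ∫ y, g (coords y) ∂(κ T.toNNReal x) = _; rw [hTt]
    have eH : ∀ x, PH 0 x = h (coords x) := fun x => by rw [hPH]; exact h0 cH x
    rw [hΨ]
    exact integral_congr_ae (ae_of_all _ fun x => by simp only [sub_zero, eF x, eG x, eH x])
  rw [← hΨT, ← hΨ0]
  have hMbT : Mb * T = 16 * (t : ℝ) * Real.exp (2 * (lam * T)) * S * IH := by rw [hMb, hT]; ring
  rw [abs_le]
  constructor <;> linarith [hΘup, hΘdown, hMbT]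

end Summit.QuantumFields.YangMills.Theorems.ColdStartUniversality.LiebRobinson

end
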